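import Literature.MathematicalPhysics.QuantumLattice.HubbardFreeCovariance
import Literature.Analysis.SpecialFunctions.MatsubaraSum
import HarnessLib

/-!
# The symmetric Matsubara truncation carries the MIDPOINT equal-time value `n_F − ½`

Topic `Literature/MathematicalPhysics/QuantumLattice`.  For the tree's finite frequency set
`MatsubaraIdx M = Fin (2M)`, `ωᵢ = π(2n+1)/β`, `n = i − M ∈ [−M, M)` (`HubbardFreeCovariance.lean`,
symmetric under `ω ↦ −ω`: `matsubaraFreq_rev`) and the propagator `1/(iω − ξ)` WITHOUT convergence factor,
the truncated equal-time loop of a mode of energy `ξ` is real,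

  `Σᵢ 1/(iωᵢ − ξ) = −ξ Σᵢ 1/(ωᵢ² + ξ²)`   (`sum_inv_I_mul_matsubaraFreq_sub`),

and as `M → ∞`

  `(1/β) Σᵢ 1/(iωᵢ − ξ) ⟶ (1 + e^{βξ})⁻¹ − ½ = n_F(ξ) − ½`   (`tendsto_truncatedTadpole`),

the MIDPOINT `½(g(0⁺) + g(0⁻))` of the time-ordered propagator, not the operator density `n_F(ξ) = g(0⁻)`
(Giuliani–Mastropietro 2010, App. A (A.19)–(A.21); it is the reason why the Grassmann interaction realising
`U(n↑ − ½)(n↓ − ½)` carries no bilinear term, ibid. after (2.6a)).  In BGM's convention `ĝ = 1/(−ik₀ + ξ)`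
the limit is `½ − n_F(ξ)` (`tendsto_truncatedTadpole_bgm`).  The frequency sum itself:
`Σᵢ 1/(ωᵢ² + ξ²) = 2 Σ_{n<M} 1/(((2n+1)π/β)² + ξ²) ⟶ β tanh(βξ/2)/(2ξ)` (`ξ ≠ 0`;
`sum_matsubaraIdx_one_div_sq_add_sq`, `tendsto_sum_matsubaraIdx_one_div_sq_add_sq`, from
`Literature.Analysis.SpecialFunctions.tsum_one_div_matsubara_sq_add_sq`).  Everything is proved. [folklore]

## Sources

A. Giuliani, V. Mastropietro, *The two-dimensional Hubbard model on the honeycomb lattice*, Commun. Math.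
Phys. 293 (2010) 301–346, §2 (2.6a) and Appendix A (A.19)–(A.21) [`GiulianiMastropietro2010`, arXiv:0811.1881];
G. Benfatto, A. Giuliani, V. Mastropietro, Ann. Henri Poincaré 7 (2006) 809, §2.1 (2.2)–(2.6)
[`BenfattoGiulianiMastropietro2006`]; A. L. Fetter, J. D. Walecka, *Quantum Theory of Many-Particle Systems*
(1971), §25. [folklore]
-/

noncomputable section

namespace Literature.MathematicalPhysics.QuantumLattice

open Finset Filter Literature.Analysis.SpecialFunctions
open scoped Topology Real

/-! ### Reflection symmetry of the truncated frequency set -/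

/-- A sum over the symmetric frequency set is invariant under `ω ↦ −ω` (pairing `i ↔ rev i`).
[cite: GiulianiMastropietro2010, App. A (A.19)–(A.21)] -/
theorem sum_matsubaraIdx_reflect {α : Type*} [AddCommMonoid α] (β : ℝ) (M : ℕ) (f : ℝ → α) :
    ∑ i : MatsubaraIdx M, f (matsubaraFreq β M i) = ∑ i : MatsubaraIdx M, f (-matsubaraFreq β M i) := by
  refine Fintype.sum_equiv Fin.revPerm _ _ fun i => ?_
  simp [Fin.revPerm_apply, matsubaraFreq_rev]

/-- **The truncated loop at `ξ = 0` vanishes identically** for every `M` (the operator value would be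
`β n_F(0) = β/2`). [cite: GiulianiMastropietro2010, App. A (A.21)] -/
theorem sum_inv_I_mul_matsubaraFreq (β : ℝ) (M : ℕ) :
    ∑ i : MatsubaraIdx M, (1 : ℂ) / (Complex.I * (matsubaraFreq β M i : ℂ)) = 0 := by
  -- adapted from Cruxes/AposterioriOrderCriterionR/DrefuteTadpole.lean (tadpole_zero)
  have h := sum_matsubaraIdx_reflect β M (fun ω => (1 : ℂ) / (Complex.I * (ω : ℂ)))
  simp only [Complex.ofReal_neg, mul_neg, div_neg, Finset.sum_neg_distrib] at h
  linear_combination (1 / 2 : ℂ) * h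

/-- Pointwise pairing: `1/(iω − ξ) + 1/(−iω − ξ) = −2ξ/(ω² + ξ²)` (also at the junk points).
[cite: GiulianiMastropietro2010, App. A (A.21)] -/
theorem inv_I_mul_sub_add_inv_neg (ω ξ : ℝ) :
    (1 : ℂ) / (Complex.I * ω - ξ) + 1 / (-(Complex.I * ω) - ξ) = ((-2 * ξ / (ω ^ 2 + ξ ^ 2) : ℝ) : ℂ) := by
  -- adapted from Cruxes/AposterioriOrderCriterionR/DrefuteTadpole.lean (pair_identity)
  rcases eq_or_ne (ω ^ 2 + ξ ^ 2) 0 with h0 | h0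
  · have hω : ω = 0 := by nlinarith [sq_nonneg ω, sq_nonneg ξ]
    have hξ : ξ = 0 := by nlinarith [sq_nonneg ω, sq_nonneg ξ]
    simp [hω, hξ]
  · have h1 : (Complex.I * ω - ξ) ≠ 0 := by
      intro h
      have := congrArg Complex.normSq h
      simp [Complex.normSq_apply] at this
      apply h0; nlinarith [sq_nonneg ω, sq_nonneg ξ]
    have h2 : (-(Complex.I * ω) - (ξ : ℂ)) ≠ 0 := by
      intro h
      have := congrArg Complex.normSq h
      simp [Complex.normSq_apply] at this
      apply h0; nlinarith [sq_nonneg ω, sq_nonneg ξ]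
    have h0' : ((ω : ℂ) ^ 2 + (ξ : ℂ) ^ 2) ≠ 0 := by exact_mod_cast h0
    push_cast
    field_simp
    ring_nf
    simp [Complex.I_sq]

/-- **The truncated equal-time loop is real**: `Σᵢ 1/(iωᵢ − ξ) = −ξ Σᵢ 1/(ωᵢ² + ξ²)` for every `β`, `M`,
`ξ` (the odd part cancels over the symmetric frequency set). [cite: GiulianiMastropietro2010, App. A (A.21)] -/
theorem sum_inv_I_mul_matsubaraFreq_sub (β : ℝ) (M : ℕ) (ξ : ℝ) :
    ∑ i : MatsubaraIdx M, (1 : ℂ) / (Complex.I * (matsubaraFreq β M i : ℂ) - ξ) =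
      ((∑ i : MatsubaraIdx M, -ξ / (matsubaraFreq β M i ^ 2 + ξ ^ 2) : ℝ) : ℂ) := by
  -- adapted from Cruxes/AposterioriOrderCriterionR/DrefuteTadpole.lean (tadpole_eq_real)
  have h := sum_matsubaraIdx_reflect β M (fun ω => (1 : ℂ) / (Complex.I * (ω : ℂ) - ξ))
  have h2 : 2 * ∑ i : MatsubaraIdx M, (1 : ℂ) / (Complex.I * (matsubaraFreq β M i : ℂ) - ξ) =
      ∑ i : MatsubaraIdx M, ((1 : ℂ) / (Complex.I * (matsubaraFreq β M i : ℂ) - ξ) +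
        1 / (-(Complex.I * (matsubaraFreq β M i : ℂ)) - ξ)) := by
    rw [Finset.sum_add_distrib, two_mul]
    congr 1
    simpa [Complex.ofReal_neg, mul_neg] using h
  have h3 : ∑ i : MatsubaraIdx M, ((1 : ℂ) / (Complex.I * (matsubaraFreq β M i : ℂ) - ξ) +
        1 / (-(Complex.I * (matsubaraFreq β M i : ℂ)) - ξ)) =
      ∑ i : MatsubaraIdx M, (((-2 * ξ / (matsubaraFreq β M i ^ 2 + ξ ^ 2) : ℝ) : ℂ)) :=
    Finset.sum_congr rfl fun i _ => inv_I_mul_sub_add_inv_neg _ _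
  rw [h3] at h2
  push_cast at h2 ⊢
  have : ∑ i : MatsubaraIdx M, (-2 * (ξ : ℂ) / ((matsubaraFreq β M i : ℂ) ^ 2 + (ξ : ℂ) ^ 2)) =
      2 * ∑ i : MatsubaraIdx M, (-(ξ : ℂ) / ((matsubaraFreq β M i : ℂ) ^ 2 + (ξ : ℂ) ^ 2)) := by
    rw [Finset.mul_sum]; refine Finset.sum_congr rfl fun i _ => ?_; ring
  rw [this] at h2
  exact mul_left_cancel₀ (two_ne_zero' ℂ) h2

/-! ### The frequency sum `Σᵢ 1/(ωᵢ² + ξ²)`: one-sided form and limit -/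

/-- **One-sided form of the truncated frequency sum**: the negative frequencies `ω_{−n−1} = −ωₙ` contribute
the same as the nonnegative ones, `Σᵢ 1/(ωᵢ² + ξ²) = 2 Σ_{n<M} 1/(((2n+1)π/β)² + ξ²)`. [folklore] -/
theorem sum_matsubaraIdx_one_div_sq_add_sq (β ξ : ℝ) (M : ℕ) :
    ∑ i : MatsubaraIdx M, 1 / (matsubaraFreq β M i ^ 2 + ξ ^ 2) =
      2 * ∑ n ∈ Finset.range M, 1 / (((2 * n + 1) * π / β) ^ 2 + ξ ^ 2) := by
  set f : ℕ → ℝ := fun i => 1 / (((2 * (i : ℝ) - 2 * M + 1) * π / β) ^ 2 + ξ ^ 2) with hf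
  have key : ∀ i : MatsubaraIdx M, 1 / (matsubaraFreq β M i ^ 2 + ξ ^ 2) = f (i : ℕ) := by
    intro i
    simp only [hf, matsubaraFreq, matsubaraInt]
    push_cast
    ring_nf
  have hsum : ∑ i : MatsubaraIdx M, 1 / (matsubaraFreq β M i ^ 2 + ξ ^ 2) = ∑ i ∈ Finset.range (2 * M), f i := by
    rw [← Fin.sum_univ_eq_sum_range]
    exact Finset.sum_congr rfl fun i _ => key i
  rw [hsum, two_mul M, Finset.sum_range_add]
  -- the nonnegative frequencies `n = j`, `i = M + j`
  have hpos : ∑ j ∈ Finset.range M, f (M + j) = ∑ n ∈ Finset.range M, 1 / (((2 * n + 1) * π / β) ^ 2 + ξ ^ 2) := by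
    refine Finset.sum_congr rfl fun j _ => ?_
    simp only [hf]
    push_cast
    ring_nf
  -- the negative frequencies `n = −m−1`, `i = M − 1 − m`
  have hneg : ∑ i ∈ Finset.range M, f i = ∑ n ∈ Finset.range M, 1 / (((2 * n + 1) * π / β) ^ 2 + ξ ^ 2) := by
    rw [← Finset.sum_range_reflect f M]
    refine Finset.sum_congr rfl fun m hm => ?_
    have hm' : m < M := Finset.mem_range.1 hm
    have hcast : ((M - 1 - m : ℕ) : ℝ) = (M : ℝ) - 1 - m := by
      rw [Nat.sub_sub, Nat.cast_sub (by omega)]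
      push_cast
      ring
    simp only [hf, hcast]
    congr 1
    ring
  rw [hneg, hpos, two_mul]

/-- **The truncated fermionic Matsubara sum converges**: `Σᵢ 1/(ωᵢ² + ξ²) ⟶ β tanh(βξ/2)/(2ξ)` as `M → ∞`
(`β > 0`, `ξ ≠ 0`). [cite: BenfattoGiulianiMastropietro2006, §2.1 (2.2)–(2.5)] -/
theorem tendsto_sum_matsubaraIdx_one_div_sq_add_sq {β ξ : ℝ} (hβ : 0 < β) (hξ : ξ ≠ 0) :
    Tendsto (fun M : ℕ => ∑ i : MatsubaraIdx M, 1 / (matsubaraFreq β M i ^ 2 + ξ ^ 2)) atTop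
      (𝓝 (β * Real.tanh (β * ξ / 2) / (2 * ξ))) := by
  have hs := summable_one_div_matsubara_sq_add_sq hβ ξ
  have hv := tsum_one_div_matsubara_sq_add_sq hβ hξ
  have h0 : HasSum (fun n : ℕ => 1 / (((2 * n + 1) * π / β) ^ 2 + ξ ^ 2)) (β * Real.tanh (β * ξ / 2) / (4 * ξ)) := by
    rw [← hv]; exact hs.hasSum
  have h1 := (h0.tendsto_sum_nat).const_mul 2
  have heq : (2 : ℝ) * (β * Real.tanh (β * ξ / 2) / (4 * ξ)) = β * Real.tanh (β * ξ / 2) / (2 * ξ) := by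
    field_simp
    ring
  rw [heq] at h1
  refine h1.congr fun M => ?_
  rw [sum_matsubaraIdx_one_div_sq_add_sq]

/-! ### The midpoint value of the truncated equal-time loop -/

/-- `(1 + eˣ)⁻¹ − ½ = −½ tanh(x/2)`. [folklore] -/
theorem inv_one_add_exp_sub_half (x : ℝ) : (1 + Real.exp x)⁻¹ - 1 / 2 = -(Real.tanh (x / 2)) / 2 := by
  rw [tanh_half_eq]
  have hpos : 0 < Real.exp x + 1 := by positivity
  have hpos' : 0 < 1 + Real.exp x := by positivity
  field_simp
  ring

/-- **The symmetric Matsubara truncation carries the midpoint equal-time value**: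
`(1/β) Σᵢ 1/(iωᵢ − ξ) ⟶ (1 + e^{βξ})⁻¹ − ½ = n_F(ξ) − ½` as `M → ∞` (`β > 0`, every `ξ`) — the average of
the two one-sided limits of the time-ordered propagator, NOT the density `n_F(ξ)`; hence a plain quartic
Grassmann vertex realises the symmetrised interaction `U(n↑ − ½)(n↓ − ½)`.
[cite: GiulianiMastropietro2010, App. A (A.19)–(A.21)] -/
theorem tendsto_truncatedTadpole {β : ℝ} (hβ : 0 < β) (ξ : ℝ) :
    Tendsto (fun M : ℕ => (1 / (β : ℂ)) * ∑ i : MatsubaraIdx M, (1 : ℂ) / (Complex.I * (matsubaraFreq β M i : ℂ) - ξ))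
      atTop (𝓝 ((((1 + Real.exp (β * ξ))⁻¹ - 1 / 2 : ℝ) : ℂ))) := by
  rcases eq_or_ne ξ 0 with rfl | hξ
  · -- at `ξ = 0` the truncated loop is `0` for every `M`, and `n_F(0) − ½ = 0`
    have hval : (((1 + Real.exp (β * 0))⁻¹ - 1 / 2 : ℝ) : ℂ) = 0 := by norm_num
    rw [hval]
    refine tendsto_const_nhds.congr fun M => ?_
    simp only [Complex.ofReal_zero, sub_zero]
    rw [sum_inv_I_mul_matsubaraFreq, mul_zero]
  · -- real form and the frequency sum
    have hlim := tendsto_sum_matsubaraIdx_one_div_sq_add_sq hβ hξ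
    have hreal : ∀ M : ℕ, (1 / (β : ℂ)) * ∑ i : MatsubaraIdx M, (1 : ℂ) / (Complex.I * (matsubaraFreq β M i : ℂ) - ξ) =
        (((-ξ / β) * ∑ i : MatsubaraIdx M, 1 / (matsubaraFreq β M i ^ 2 + ξ ^ 2) : ℝ) : ℂ) := by
      intro M
      rw [sum_inv_I_mul_matsubaraFreq_sub]
      push_cast
      rw [Finset.mul_sum, Finset.mul_sum]
      refine Finset.sum_congr rfl fun i _ => ?_
      ring
    have hval : (((1 + Real.exp (β * ξ))⁻¹ - 1 / 2 : ℝ) : ℂ) =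
        (((-ξ / β) * (β * Real.tanh (β * ξ / 2) / (2 * ξ)) : ℝ) : ℂ) := by
      rw [inv_one_add_exp_sub_half, show β * ξ / 2 = (β * ξ) / 2 from rfl]
      congr 1
      field_simp
    rw [hval]
    have h2 := ((Complex.continuous_ofReal.tendsto _).comp (hlim.const_mul (-ξ / β)))
    refine h2.congr fun M => ?_
    simp only [Function.comp_apply]
    exact (hreal M).symm

/-- **BGM convention** `ĝ(k) = 1/(−ik₀ + ξ)` (`nambuPropagator_zero_seed`): the truncated loop
`(1/β) Σᵢ 1/(−iωᵢ + ξ)` tends to `½ − n_F(ξ)` — the midpoint of `⟨T a(τ)a⁺(0)⟩` at `τ = 0`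
(`1 − n_F` from the right, `−n_F` from the left). [cite: GiulianiMastropietro2010, App. A (A.20)–(A.21)] -/
theorem tendsto_truncatedTadpole_bgm {β : ℝ} (hβ : 0 < β) (ξ : ℝ) :
    Tendsto (fun M : ℕ => (1 / (β : ℂ)) * ∑ i : MatsubaraIdx M, (1 : ℂ) / (-(Complex.I * (matsubaraFreq β M i : ℂ)) + ξ))
      atTop (𝓝 (((1 / 2 - (1 + Real.exp (β * ξ))⁻¹ : ℝ) : ℂ))) := by
  have h := (tendsto_truncatedTadpole hβ ξ).neg
  have hval : -((((1 + Real.exp (β * ξ))⁻¹ - 1 / 2 : ℝ) : ℂ)) = ((1 / 2 - (1 + Real.exp (β * ξ))⁻¹ : ℝ) : ℂ) := by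
    push_cast; ring
  rw [hval] at h
  refine h.congr fun M => ?_
  rw [neg_mul_eq_mul_neg, ← Finset.sum_neg_distrib]
  congr 1
  refine Finset.sum_congr rfl fun i _ => ?_
  rw [← div_neg]
  congr 1
  ring

end Literature.MathematicalPhysics.QuantumLattice
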